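import Summits.CriticalPhenomena.PercolationContinuityZ3.Theorems.PercNearOneGluingNoHeavyLowerTailAntitheticCycleFlip
import Summits.CriticalPhenomena.PercolationContinuityZ3.Theorems.PercNearOneGluingNoHeavyLowerTailAntitheticChangeQuad
import HarnessLib

/-!
# `NoHeavyLowerTail` (stmt-CriticalPhenomena-4575) — antithetic cluster pairs: THEOREM C′, the BULK CLASSES on the cycle — clusters of the four
# members of a bulk class and the nonnegativity of the class sum (prim-hp-2 gen 42; HOME/THEOREM-Cprime-delta2-cycle.md §2–§4)

Support file (`--supports stmt-CriticalPhenomena-4575`, hull-port prover `prim-hp-2`, gen 42).  No definitions, no named facts, no sorries; standard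
axioms.

SETTING: cycle `v 0 = s, …, v (n−1)` (…CycleRuns), `E₀ = Cyc.edgeSet n v`; `y = v p`, `z = v q` two cycle vertices other than `s`; markers `e, f`
(the pairs `xy`, `xz` of THEOREM C′; here arbitrary).  A colouring `ω` lies in the `rr` BULK CLASS `(i, j)` if its clockwise run from `s` is red of length
exactly `i ≥ 1`, its counter-clockwise run red of length exactly `j ≥ 1`, and `i + j + 2 ≤ n` (…CycleFlip: `cwRun`, `ccwRun`).  Its three partners are
`ω ∆ sufBlock j` (`rb`), `ω ∆ preBlock i` (`br`) and `(ω ∆ preBlock i) ∆ sufBlock j` (`bb`).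
* `Cyc.Bulk.runSet` — the edge set `{edge k : k < n, k < a ∨ n ≤ k + b}` (the red cluster of a colouring with `pre = a`, `suf = b`, `Cyc.openEdgeCluster_eq`);
* `Cyc.Bulk.clusters_rr/rb/br/bb` — the red/blue edge clusters of the four members: `(A, ∅)`, `(P, Q)`, `(Q, P)`, `(∅, A)` with `A = runSet i j`,
  `P = runSet i 0`, `Q = runSet 0 j`;
* `Cyc.Bulk.seen_iff` — a cycle vertex `v a` (`0 < a < n`) is seen by `runSet i j` iff `a ≤ i ∨ n ≤ a + j`;
* `Cyc.Bulk.quad_nonneg` — **the class sum is nonnegative**: with the pendant lifts `L_y = liftSet s y e`, `L_z = liftSet s z f` and the mixed-pair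
  constraint deciding which of `rb`, `br` are present (…AntitheticChangeQuad `Quad.quad_lift_nonneg`; the geometric inputs are "`y` is not seen by both
  `P` and `Q`", idem `z`, which is `i + j + 2 ≤ n`).
[cite: VandenbergHaggstromKahn2005, §1 p. 3 (open cluster `C_s`)]
-/

noncomputable section

namespace Summit.CriticalPhenomena.PercolationContinuityZ3.Theorems

open Literature.Probability.Percolation
open scoped Classical symmDiff

namespace Antithetic

namespace Cyc

namespace Bulk

variable {V : Type*} (n : ℕ) (v : ℕ → V)

/-- The edge set `{edge k : k < n, k < a ∨ n ≤ k + b}` — the red cluster of a colouring with prefix run `a` and suffix run `b`. [this work] -/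
def runSet (a b : ℕ) : Set (Sym2 V) := {e | ∃ k, k < n ∧ e = edge v k ∧ (k < a ∨ n ≤ k + b)}

variable {n v}

/-- Reachability of a cycle vertex in a colouring is "being seen" by the edge cluster. [this work] -/
theorem reach_iff_seen (η : Set (Sym2 V)) (u : V) :
    (openGraph (η ∩ edgeSet n v)).Reachable (v 0) u ↔ (u = v 0 ∨ ∃ g ∈ openEdgeCluster (η ∩ edgeSet n v) (v 0), u ∈ g) :=
  Pendant.reachable_iff_cluster _ u (v 0)

/-- `runSet 0 0 = ∅`. [this work] -/
theorem runSet_zero : runSet n v 0 0 = ∅ := by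
  ext e
  simp only [runSet, Set.mem_setOf_eq, Set.mem_empty_iff_false, iff_false, not_exists, not_and]
  intro k hk _ h
  omega

/-- `runSet` is monotone in both run lengths. [this work] -/
theorem runSet_mono {a b a' b' : ℕ} (ha : a ≤ a') (hb : b ≤ b') : runSet n v a b ⊆ runSet n v a' b' := by
  rintro e ⟨k, hk, rfl, h⟩
  exact ⟨k, hk, rfl, by omega⟩

/-- The red cluster of a colouring in terms of `pre`/`suf` (restatement of `Cyc.openEdgeCluster_eq`). [this work] -/
theorem cluster_eq_runSet (hn : 3 ≤ n) (hinj : ∀ i j, i < n → j < n → v i = v j → i = j) (hper : v n = v 0) (ω : Set (Sym2 V)) :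
    openEdgeCluster (ω ∩ edgeSet n v) (v 0) = runSet n v (pre n v ω) (suf n v ω) :=
  openEdgeCluster_eq ω hn hinj hper

section Geometry

variable (hn : 3 ≤ n) (hinj : ∀ i j, i < n → j < n → v i = v j → i = j) (hper : v n = v 0)
include hn hinj hper

/-- A cycle vertex `v a`, `0 < a < n`, is seen by (is `s` or an endpoint of a pair of) `runSet i j` (`i + j < n` or not) iff `a ≤ i ∨ n ≤ a + j` —
via red reachability in a colouring with these runs; here stated directly for the set. [this work] -/
theorem seen_iff {a i j : ℕ} (ha0 : 0 < a) (han : a < n) :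
    (v a = v 0 ∨ ∃ g ∈ runSet n v i j, v a ∈ g) ↔ (a ≤ i ∨ n ≤ a + j) := by
  constructor
  · rintro (h | ⟨g, ⟨k, hk, rfl, hkij⟩, hag⟩)
    · exact absurd (hinj a 0 han (by omega) h) (by omega)
    · unfold edge at hag
      rcases Sym2.mem_iff.1 hag with h | h
      · have := hinj a k han hk h
        omega
      · rcases idx_eq hn hinj hper han.le (by omega : k + 1 ≤ n) h with h1 | ⟨h1, -⟩ | ⟨h1, -⟩
        · omega
        · omega
        · omega
  · rintro (h | h)
    · -- `v a` is the far endpoint of `edge (a-1)`, and `a - 1 < i`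
      refine Or.inr ⟨edge v (a - 1), ⟨a - 1, by omega, rfl, Or.inl (by omega)⟩, ?_⟩
      unfold edge
      rw [show a - 1 + 1 = a by omega]
      exact Sym2.mem_mk_right _ _
    · refine Or.inr ⟨edge v a, ⟨a, han, rfl, Or.inr h⟩, ?_⟩
      exact Sym2.mem_mk_left _ _

end Geometry

section Clusters

variable (hn : 3 ≤ n) (hinj : ∀ i j, i < n → j < n → v i = v j → i = j) (hper : v n = v 0)
include hn hinj hper

variable {ω : Set (Sym2 V)} {i j : ℕ}

/-- **Clusters of the `rr` member**: red `runSet i j`, blue `∅`. [this work] -/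
theorem clusters_rr (hcw : ω ∈ cwRun n v True i) (hccw : ω ∈ ccwRun n v True j) (hi : 0 < i) (hj : 0 < j) (hij : i + j + 2 ≤ n) :
    openEdgeCluster (ω ∩ edgeSet n v) (v 0) = runSet n v i j ∧ openEdgeCluster (ωᶜ ∩ edgeSet n v) (v 0) = ∅ := by
  have h1 : pre n v ω = i := cwRun_pre ω hcw trivial (by omega)
  have h2 : suf n v ω = j := ccwRun_suf ω hccw trivial (by omega)
  have h3 : pre n v ωᶜ = 0 := (cwRun_pre_other ω hcw hi).1 trivial
  have h4 : suf n v ωᶜ = 0 := (ccwRun_suf_other ω hccw hj).1 trivial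
  refine ⟨by rw [cluster_eq_runSet hn hinj hper, h1, h2], by rw [cluster_eq_runSet hn hinj hper, h3, h4, runSet_zero]⟩

/-- **Clusters of the `rb` member** `ω ∆ sufBlock j`: red `runSet i 0`, blue `runSet 0 j`. [this work] -/
theorem clusters_rb (hcw : ω ∈ cwRun n v True i) (hccw : ω ∈ ccwRun n v True j) (hi : 0 < i) (hj : 0 < j) (hij : i + j + 2 ≤ n) :
    openEdgeCluster ((ω ∆ sufBlock n v j) ∩ edgeSet n v) (v 0) = runSet n v i 0 ∧
      openEdgeCluster ((ω ∆ sufBlock n v j)ᶜ ∩ edgeSet n v) (v 0) = runSet n v 0 j := by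
  have hcw' := cwRun_sufBlock hn hinj hper ω hcw hij
  have hccw' := ccwRun_flip hn hinj hper ω hccw (by omega)
  have h1 : pre n v (ω ∆ sufBlock n v j) = i := cwRun_pre _ hcw' trivial (by omega)
  have h2 : suf n v (ω ∆ sufBlock n v j) = 0 := (ccwRun_suf_other _ hccw' hj).2 (fun h => h trivial)
  have h3 : pre n v (ω ∆ sufBlock n v j)ᶜ = 0 := (cwRun_pre_other _ hcw' hi).1 trivial
  have h4 : suf n v (ω ∆ sufBlock n v j)ᶜ = j := ccwRun_suf_compl _ hccw' (fun h => h trivial) (by omega)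
  refine ⟨by rw [cluster_eq_runSet hn hinj hper, h1, h2], by rw [cluster_eq_runSet hn hinj hper, h3, h4]⟩

/-- **Clusters of the `br` member** `ω ∆ preBlock i`: red `runSet 0 j`, blue `runSet i 0`. [this work] -/
theorem clusters_br (hcw : ω ∈ cwRun n v True i) (hccw : ω ∈ ccwRun n v True j) (hi : 0 < i) (hj : 0 < j) (hij : i + j + 2 ≤ n) :
    openEdgeCluster ((ω ∆ preBlock v i) ∩ edgeSet n v) (v 0) = runSet n v 0 j ∧
      openEdgeCluster ((ω ∆ preBlock v i)ᶜ ∩ edgeSet n v) (v 0) = runSet n v i 0 := by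
  have hcw' := cwRun_flip hn hinj hper ω hcw (by omega)
  have hccw' := ccwRun_preBlock hn hinj hper ω hccw hij
  have h1 : pre n v (ω ∆ preBlock v i) = 0 := (cwRun_pre_other _ hcw' hi).2 (fun h => h trivial)
  have h2 : suf n v (ω ∆ preBlock v i) = j := ccwRun_suf _ hccw' trivial (by omega)
  have h3 : pre n v (ω ∆ preBlock v i)ᶜ = i := cwRun_pre_compl _ hcw' (fun h => h trivial) (by omega)
  have h4 : suf n v (ω ∆ preBlock v i)ᶜ = 0 := (ccwRun_suf_other _ hccw' hj).1 trivial
  refine ⟨by rw [cluster_eq_runSet hn hinj hper, h1, h2], by rw [cluster_eq_runSet hn hinj hper, h3, h4]⟩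

/-- **Clusters of the `bb` member** `(ω ∆ preBlock i) ∆ sufBlock j`: red `∅`, blue `runSet i j`. [this work] -/
theorem clusters_bb (hcw : ω ∈ cwRun n v True i) (hccw : ω ∈ ccwRun n v True j) (hi : 0 < i) (hj : 0 < j) (hij : i + j + 2 ≤ n) :
    openEdgeCluster (((ω ∆ preBlock v i) ∆ sufBlock n v j) ∩ edgeSet n v) (v 0) = ∅ ∧
      openEdgeCluster (((ω ∆ preBlock v i) ∆ sufBlock n v j)ᶜ ∩ edgeSet n v) (v 0) = runSet n v i j := by
  have hcw1 := cwRun_flip hn hinj hper ω hcw (by omega)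
  have hccw1 := ccwRun_preBlock hn hinj hper ω hccw hij
  have hcw' := cwRun_sufBlock hn hinj hper _ hcw1 hij
  have hccw' := ccwRun_flip hn hinj hper _ hccw1 (by omega)
  have h1 : pre n v ((ω ∆ preBlock v i) ∆ sufBlock n v j) = 0 := (cwRun_pre_other _ hcw' hi).2 (fun h => h trivial)
  have h2 : suf n v ((ω ∆ preBlock v i) ∆ sufBlock n v j) = 0 := (ccwRun_suf_other _ hccw' hj).2 (fun h => h trivial)
  have h3 : pre n v ((ω ∆ preBlock v i) ∆ sufBlock n v j)ᶜ = i := cwRun_pre_compl _ hcw' (fun h => h trivial) (by omega)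
  have h4 : suf n v ((ω ∆ preBlock v i) ∆ sufBlock n v j)ᶜ = j := ccwRun_suf_compl _ hccw' (fun h => h trivial) (by omega)
  refine ⟨by rw [cluster_eq_runSet hn hinj hper, h1, h2, runSet_zero], by rw [cluster_eq_runSet hn hinj hper, h3, h4]⟩

end Clusters

section Quad

variable (hn : 3 ≤ n) (hinj : ∀ i j, i < n → j < n → v i = v j → i = j) (hper : v n = v 0)
include hn hinj hper

/-- **The bulk class sum is nonnegative.**  For `ω` in the `rr` bulk class `(i, j)` (`1 ≤ i, j`, `i + j + 2 ≤ n`), cycle vertices `y = v p`, `z = v q`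
(`0 < p, q < n`), markers `e, f` and monotone `F, G`: with `Φ(φ) := (F(L_y C(φ)) − F(L_z C′(φ)))(G(L_y C(φ)) − G(L_z C′(φ)))` and
`kept(φ) := ¬(y red-reached ∧ z blue-reached in φ)`,
`Φ(ω) + [kept]Φ(ω ∆ sufBlock j) + [kept]Φ(ω ∆ preBlock i) + Φ((ω ∆ preBlock i) ∆ sufBlock j) ≥ 0` (the `rr` and `bb` members are always kept). [this work] -/
theorem quad_nonneg {F G : Set (Sym2 V) → ℝ} (hF : Monotone F) (hG : Monotone G) {p q : ℕ} (hp0 : 0 < p) (hpn : p < n) (hq0 : 0 < q)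
    (hqn : q < n) (e f : Sym2 V) {ω : Set (Sym2 V)} {i j : ℕ} (hcw : ω ∈ cwRun n v True i) (hccw : ω ∈ ccwRun n v True j) (hi : 0 < i)
    (hj : 0 < j) (hij : i + j + 2 ≤ n) :
    let Φ : Set (Sym2 V) → ℝ := fun φ =>
      (F (Pendant.liftSet (v 0) (v p) e (openEdgeCluster (φ ∩ edgeSet n v) (v 0))) -
          F (Pendant.liftSet (v 0) (v q) f (openEdgeCluster (φᶜ ∩ edgeSet n v) (v 0)))) *
        (G (Pendant.liftSet (v 0) (v p) e (openEdgeCluster (φ ∩ edgeSet n v) (v 0))) -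
          G (Pendant.liftSet (v 0) (v q) f (openEdgeCluster (φᶜ ∩ edgeSet n v) (v 0))))
    let kept : Set (Sym2 V) → Prop := fun φ =>
      ¬ ((openGraph (φ ∩ edgeSet n v)).Reachable (v 0) (v p) ∧ (openGraph (φᶜ ∩ edgeSet n v)).Reachable (v 0) (v q))
    0 ≤ Φ ω + (if kept (ω ∆ sufBlock n v j) then Φ (ω ∆ sufBlock n v j) else 0) +
      (if kept (ω ∆ preBlock v i) then Φ (ω ∆ preBlock v i) else 0) + Φ ((ω ∆ preBlock v i) ∆ sufBlock n v j) := by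
  intro Φ kept
  obtain ⟨rr1, rr2⟩ := clusters_rr hn hinj hper hcw hccw hi hj hij
  obtain ⟨rb1, rb2⟩ := clusters_rb hn hinj hper hcw hccw hi hj hij
  obtain ⟨br1, br2⟩ := clusters_br hn hinj hper hcw hccw hi hj hij
  obtain ⟨bb1, bb2⟩ := clusters_bb hn hinj hper hcw hccw hi hj hij
  -- the kept conditions in "seen" form
  have krb : kept (ω ∆ sufBlock n v j) ↔
      ¬ ((v p = v 0 ∨ ∃ g ∈ runSet n v i 0, v p ∈ g) ∧ (v q = v 0 ∨ ∃ g ∈ runSet n v 0 j, v q ∈ g)) := by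
    show ¬ (_ ∧ _) ↔ _
    rw [reach_iff_seen, reach_iff_seen, rb1, rb2]
  have kbr : kept (ω ∆ preBlock v i) ↔
      ¬ ((v p = v 0 ∨ ∃ g ∈ runSet n v 0 j, v p ∈ g) ∧ (v q = v 0 ∨ ∃ g ∈ runSet n v i 0, v q ∈ g)) := by
    show ¬ (_ ∧ _) ↔ _
    rw [reach_iff_seen, reach_iff_seen, br1, br2]
  -- geometry: y (resp. z) is not seen by both P = runSet i 0 and Q = runSet 0 j
  have NY : ¬ ((v p = v 0 ∨ ∃ g ∈ runSet n v i 0, v p ∈ g) ∧ (v p = v 0 ∨ ∃ g ∈ runSet n v 0 j, v p ∈ g)) := by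
    rw [seen_iff hn hinj hper hp0 hpn, seen_iff hn hinj hper hp0 hpn]
    omega
  have NZ : ¬ ((v q = v 0 ∨ ∃ g ∈ runSet n v i 0, v q ∈ g) ∧ (v q = v 0 ∨ ∃ g ∈ runSet n v 0 j, v q ∈ g)) := by
    rw [seen_iff hn hinj hper hq0 hqn, seen_iff hn hinj hper hq0 hqn]
    omega
  have hps : ¬ (v p = v 0 ∨ ∃ g ∈ (∅ : Set (Sym2 V)), v p ∈ g) := by
    rintro (h | ⟨g, hg, -⟩)
    · exact absurd (hinj p 0 hpn (by omega) h) (by omega)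
    · exact hg
  have hqs : ¬ (v q = v 0 ∨ ∃ g ∈ (∅ : Set (Sym2 V)), v q ∈ g) := by
    rintro (h | ⟨g, hg, -⟩)
    · exact absurd (hinj q 0 hqn (by omega) h) (by omega)
    · exact hg
  have main := Quad.quad_lift_nonneg hF hG (v 0) (v p) (v q) e f (P := runSet n v i 0) (Q := runSet n v 0 j) (A := runSet n v i j)
    (runSet_mono le_rfl (Nat.zero_le _)) (runSet_mono (Nat.zero_le _) le_rfl) NY NZ
  -- rewrite the goal into the shape of `main`
  have eΦrr : Φ ω = (F (Pendant.liftSet (v 0) (v p) e (runSet n v i j)) - F ∅) *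
      (G (Pendant.liftSet (v 0) (v p) e (runSet n v i j)) - G ∅) := by
    show (F _ - F _) * (G _ - G _) = _
    rw [rr1, rr2, Quad.liftSet_of_not hqs]
  have eΦbb : Φ ((ω ∆ preBlock v i) ∆ sufBlock n v j) = (F ∅ - F (Pendant.liftSet (v 0) (v q) f (runSet n v i j))) *
      (G ∅ - G (Pendant.liftSet (v 0) (v q) f (runSet n v i j))) := by
    show (F _ - F _) * (G _ - G _) = _
    rw [bb1, bb2, Quad.liftSet_of_not hps]
  have eΦrb : Φ (ω ∆ sufBlock n v j) = (F (Pendant.liftSet (v 0) (v p) e (runSet n v i 0)) - F (Pendant.liftSet (v 0) (v q) f (runSet n v 0 j))) *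
      (G (Pendant.liftSet (v 0) (v p) e (runSet n v i 0)) - G (Pendant.liftSet (v 0) (v q) f (runSet n v 0 j))) := by
    show (F _ - F _) * (G _ - G _) = _
    rw [rb1, rb2]
  have eΦbr : Φ (ω ∆ preBlock v i) = (F (Pendant.liftSet (v 0) (v p) e (runSet n v 0 j)) - F (Pendant.liftSet (v 0) (v q) f (runSet n v i 0))) *
      (G (Pendant.liftSet (v 0) (v p) e (runSet n v 0 j)) - G (Pendant.liftSet (v 0) (v q) f (runSet n v i 0))) := by
    show (F _ - F _) * (G _ - G _) = _
    rw [br1, br2]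
  rw [eΦrr, eΦbb, eΦrb, eΦbr]
  rw [show (if kept (ω ∆ sufBlock n v j) then _ else (0 : ℝ)) = _ from if_congr krb rfl rfl,
    show (if kept (ω ∆ preBlock v i) then _ else (0 : ℝ)) = _ from if_congr kbr rfl rfl]
  linarith [main]

end Quad

end Bulk

end Cyc

end Antithetic

end Summit.CriticalPhenomena.PercolationContinuityZ3.Theorems
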